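import Summits.BirchSwinnertonDyer.BirchSwinnertonDyer.Theorems.ManinLocalTwoThreeNoBlindThreeTorsionTameIII
import Summits.BirchSwinnertonDyer.BirchSwinnertonDyer.Theorems.ManinLocalTwoThreeShimuraRationalThreeIsogeny
import HarnessLib

/-!
# NB₃^V `NoAscendingThreeTorsionOptimal` on the tame potentially-good strata at `3` — WITHOUT optimality: a rational
# `3`-torsion point of a `III` curve never ascends, a `III*` curve has none

Summit `BirchSwinnertonDyer`, route `ManinLocalTwoThree` (cell bsd-f2-manin), deciding crux C3 `ManinPrimeToThreeAtNine`
(stmt-BirchSwinnertonDyer-22968); the lead's C3 skeleton `kato_shift_three` v14 carries the stub `stub_noAscendingThreeTorsionOptimal`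
BY NAME (`…ManinAdditive.CuspidalKummerCubeNoBlindLaws.NoAscendingThreeTorsionOptimal`: no `X₀(N)`-optimal `W` with `9 ∣ N` has a rational
point `T = (X₁, Y₁)` of order `3` on `E_{W,1}` whose Vélu `3`-quotient ASCENDS, i.e. no globally minimal `W′` carries
`(3⁻⁴A, 3⁻⁶B)`, `(A, B) = (1440X₁² − 9c₄, 60480X₁³ − 756c₄X₁ − 27c₆)`).  This file DISCHARGES that statement on the two tame
potentially-good strata at `3`, for EVERY globally minimal curve (optimality, the datum and the lattice clause are not used):

* `Ψ₃_eval_of_isShortThreeTorsion` — the bridge `IsShortThreeTorsion W 1 X₁ Y₁ → Ψ₃_W(X₁ − b₂/12) = 0`;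
* `not_exists_three_velu_three_of_isShortThreeTorsion_of_III` — `9 ∥ N(W)`, `ord₃ Δ_min = 3` (type `III`): no globally minimal carrier of
  the thrice-divided pair (E-an-107: `u = 1`; this seat's p643391 `not_exists_isGloballyMinimal_three_velu_three_of_III`);
* `not_exists_three_velu_three_of_isShortThreeTorsion_of_IIIstar` — `9 ∥ N(W)`, `ord₃ Δ_min = 9`, `ord₃ j ≥ 0` (type `III*`): vacuous, there
  is no rational `3`-torsion point (p645058 `not_isShortThreeTorsion_of_IIIstar`);
* `noAscendingThreeTorsion_of_tame_potGood_three` — both, in the stub's shape with the conductor hypotheses explicit.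

What is NOT covered (honest): the `I₀*` stratum (`ord₃ Δ_min = 6`; there a rational `3`-torsion point has `u = 3` by parity of
`ord₃ D₀`, so the law is a POSITION LAW: optimal `I₀*` curves carry no rational `3`-torsion — global) and the wild strata `27 ∣ N`.
C3, Manin's conjecture and BSD are not proved.  No definitions, no named facts, no sorry.
References: [SilvermanATAEC1994] IV.9.4 Table 4.1; [DokchitserDokchitser2015LocalInvariants] Table 1; HOME/MEMO-an.md §66–§67.
-/

set_option autoImplicit false
set_option linter.dupNamespace false

noncomputable section

open scoped Classical
open Polynomial WeierstrassCurve
open Summit.BirchSwinnertonDyer.Rank1Residual.ManinAdditive.CuspidalKummer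
open Summit.BirchSwinnertonDyer.Rank1Residual.ManinAdditive.CuspidalKummerThree

namespace Summit.BirchSwinnertonDyer.BirchSwinnertonDyer.Theorems.ManinLocalTwoThree

/-- The bridge: a rational `3`-torsion point `(X₁, Y₁)` of the short model `E_{W,1} = [0,0,0,−c₄/48,−c₆/864]` gives the `Ψ₃`-root
`X₁ − b₂/12` of `W`. [folklore] -/
theorem Ψ₃_eval_of_isShortThreeTorsion (W : WeierstrassCurve ℚ) {X₁ Y₁ : ℚ} (hT : IsShortThreeTorsion W 1 X₁ Y₁) :
    W.Ψ₃.eval (X₁ - W.b₂ / 12) = 0 := by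
  have h := hT.2
  have hS : shortModel W 1 = (⟨0, 0, 0, -W.c₄ / 48, -W.c₆ / 864⟩ : WeierstrassCurve ℚ) := by
    ext <;> simp [shortModel] <;> ring
  rw [hS, Polynomial.IsRoot] at h
  rw [Ψ₃_eval_sub_b₂_div_twelve]
  exact h

/-- **No ascent on `III`:** `W` globally minimal, `9 ∥ N(W)`, `ord₃ Δ_min = 3`, `(X₁, Y₁)` a rational `3`-torsion point of `E_{W,1}` ⟹ no
globally minimal `W′` carries `(3⁻⁴A, 3⁻⁶B)` (the Vélu `3`-isogeny has Néron scalar `u = 1` at `3`).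
[cite: SilvermanATAEC1994, IV.9.4 Table 4.1] [cite: DokchitserDokchitser2015LocalInvariants, Table 1] -/
theorem not_exists_three_velu_three_of_isShortThreeTorsion_of_III (W : WeierstrassCurve ℚ) [W.IsElliptic]
    [W.IsGloballyMinimal] (h9 : 3 ^ 2 ∣ W.conductorNorm ℤ) (h27 : ¬ 3 ^ 3 ∣ W.conductorNorm ℤ)
    (hΔ : padicValInt 3 W.minimalDiscriminantInt = 3) {X₁ Y₁ : ℚ} (hT : IsShortThreeTorsion W 1 X₁ Y₁) :
    ¬ ∃ W' : WeierstrassCurve ℚ, W'.IsElliptic ∧ W'.IsGloballyMinimal ∧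
        (3 : ℚ) ^ 4 * W'.c₄ = 1440 * X₁ ^ 2 - 9 * W.c₄ ∧
        (3 : ℚ) ^ 6 * W'.c₆ = 60480 * X₁ ^ 3 - 756 * W.c₄ * X₁ - 27 * W.c₆ :=
  not_exists_isGloballyMinimal_three_velu_three_of_III W h9 h27 hΔ X₁ (Ψ₃_eval_of_isShortThreeTorsion W hT)

/-- **No ascent on `III*` (vacuously):** `9 ∥ N(W)`, `ord₃ Δ_min = 9`, `ord₃ j ≥ 0` ⟹ `E_{W,1}` has no rational `3`-torsion point at all.
[cite: SilvermanATAEC1994, IV.9.4 Table 4.1] -/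
theorem not_exists_three_velu_three_of_isShortThreeTorsion_of_IIIstar (W : WeierstrassCurve ℚ) [W.IsElliptic]
    [W.IsGloballyMinimal] (h9 : 3 ^ 2 ∣ W.conductorNorm ℤ) (h27 : ¬ 3 ^ 3 ∣ W.conductorNorm ℤ)
    (hΔ : padicValInt 3 W.minimalDiscriminantInt = 9) (hj : 0 ≤ padicValRat 3 W.j) {X₁ Y₁ : ℚ}
    (hT : IsShortThreeTorsion W 1 X₁ Y₁) :
    ¬ ∃ W' : WeierstrassCurve ℚ, W'.IsElliptic ∧ W'.IsGloballyMinimal ∧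
        (3 : ℚ) ^ 4 * W'.c₄ = 1440 * X₁ ^ 2 - 9 * W.c₄ ∧
        (3 : ℚ) ^ 6 * W'.c₆ = 60480 * X₁ ^ 3 - 756 * W.c₄ * X₁ - 27 * W.c₆ :=
  absurd hT (not_isShortThreeTorsion_of_IIIstar W h9 h27 hΔ hj X₁ Y₁)

/-- **NB₃^V on the tame potentially-good strata at `3`, in the stub's shape** (conductor hypotheses explicit, NO optimality): for a globally
minimal `W` with `9 ∥ N(W)` and `ord₃ Δ_min = 3`, or `ord₃ Δ_min = 9` with `ord₃ j ≥ 0`, no rational `3`-torsion point of `E_{W,1}` ascends.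
[cite: SilvermanATAEC1994, IV.9.4 Table 4.1] [cite: DokchitserDokchitser2015LocalInvariants, Table 1] -/
theorem noAscendingThreeTorsion_of_tame_potGood_three (W : WeierstrassCurve ℚ) [W.IsElliptic] [W.IsGloballyMinimal]
    (h9 : 3 ^ 2 ∣ W.conductorNorm ℤ) (h27 : ¬ 3 ^ 3 ∣ W.conductorNorm ℤ)
    (hδ : padicValInt 3 W.minimalDiscriminantInt = 3 ∨
      (padicValInt 3 W.minimalDiscriminantInt = 9 ∧ 0 ≤ padicValRat 3 W.j))
    (X₁ Y₁ : ℚ) (hT : IsShortThreeTorsion W 1 X₁ Y₁) :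
    ¬ ∃ W' : WeierstrassCurve ℚ, W'.IsElliptic ∧ W'.IsGloballyMinimal ∧
        (3 : ℚ) ^ 4 * W'.c₄ = 1440 * X₁ ^ 2 - 9 * W.c₄ ∧
        (3 : ℚ) ^ 6 * W'.c₆ = 60480 * X₁ ^ 3 - 756 * W.c₄ * X₁ - 27 * W.c₆ := by
  rcases hδ with h3 | ⟨h9Δ, hj⟩
  · exact not_exists_three_velu_three_of_isShortThreeTorsion_of_III W h9 h27 h3 hT
  · exact not_exists_three_velu_three_of_isShortThreeTorsion_of_IIIstar W h9 h27 h9Δ hj hT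

end Summit.BirchSwinnertonDyer.BirchSwinnertonDyer.Theorems.ManinLocalTwoThree

end
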